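import Literature.InformationTheory.QuantumCodes.HypergraphProduct

/-!
# The hypergraph product `HGP(H₁, H₂)` of two binary parity-check matrices (venture-side wrapper)

LADDER-QEC (venture cell `qec`, PARTITION row type-04), `Summits/Ventures/QEC/Basic/`. This file is the
INSTANCE-LEVEL interface the census / search seats use: for `H₁ : Matrix (Fin m₁) (Fin n₁) 𝔽₂` and
`H₂ : Matrix (Fin m₂) (Fin n₂) 𝔽₂` (parity-check matrices of classical codes `C₁ = ker H₁`,
`C₂ = ker H₂`) the CSS pair
`HX = [H₁ ⊗ 1 | 1 ⊗ H₂ᵀ]` (rows `Fin m₁ × Fin n₂`), `HZ = [1 ⊗ H₂ | H₁ᵀ ⊗ 1]` (rows `Fin n₁ × Fin m₂`) on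
the qubit set `(Fin n₁ × Fin n₂) ⊕ (Fin m₁ × Fin m₂)` (`n₁n₂ + m₁m₂` qubits), with `HX * HZᵀ = 0` PROVED.

Everything mathematical is IMPORTED from the Literature side
(`Literature.InformationTheory.QuantumCodes.HypergraphProduct`, Tillich–Zémor 2014 [TillichZemor2014]):
in Tillich–Zémor's labelling `HGP(H₁,H₂)` is the quantum code of the product hypergraph `ℋ₁·ℋ₂ᵀ` (the
SECOND factor is the transpose hypergraph of `H₂`), and the definitions below are LITERALLY
`HypergraphProduct.xMatrix H₁ H₂ᵀ`, `HypergraphProduct.zMatrix H₁ H₂ᵀ` (`HX_eq`, `HZ_eq` display the block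
form). Dictionary for the printed theorems (TZ Thm 7 / Thm 9 / Lemma 10, typed there as
`HypergraphProduct.dimension_eq / minDist_ge / minDist_le`): `k = k₁`, `r = k₁ᵀ`, `h = k₂ᵀ`, `s = k₂`,
`(d₁, d₂, d₁ᵀ, d₂ᵀ)_TZ = (d₁, d₂ᵀ, d₁ᵀ, d₂)`, where `kᵢ = dim ker Hᵢ`, `kᵢᵀ = dim ker Hᵢᵀ`,
`dᵢ = d(ker Hᵢ)`, `dᵢᵀ = d(ker Hᵢᵀ)` (`⊤` for the zero code).

* `HGP.HX`, `HGP.HZ` — definitions (computable); `HGP.HX_mul_HZ_transpose` — PROVED.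
* (APPENDED as PROVED THEOREMS when the Literature-side proofs of TZ Thm 7 / Thm 9 / Lemma 10 land — no
  `def … : Prop` claims here:) `HGP.k_eq` — `n₁n₂ + m₁m₂ − rank HX − rank HZ = k₁k₂ + k₁ᵀk₂ᵀ` (TZ Thm 7 under the
  dictionary); `HGP.distance_ge` — `D ≥ min(d₁, d₂, d₁ᵀ, d₂ᵀ)` (TZ Thm 9); `HGP.distance_eq_min` — for `H₁`,
  `H₂` of full row rank with `k₁, k₂ ≥ 1`, `D = min(d₁, d₂)` (Breuckmann–Eberhardt 2021 §4.1
  "`[[n₁n₂ + r₁r₂, k₁k₂, min{d₁,d₂}]]` … with `rᵢ` linearly independent checks" [BreuckmannEberhardt2021];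
  `≤ d₂` is TZ Lemma 10 for the Poincaré dual). Without logical qubits `D = ⊤`, so the hypotheses matter.

HONEST FRAMING: nothing in this file certifies a distance of a specific code; census rows come from
certificates (`Census/`). Not here: a flattening of the qubit index to `Fin (n₁n₂ + m₁m₂)` (fixed once in
plan/CERT-FORMAT.md §index and added then), the `CSS`-structure packaging of row type-02 (a 3-line
wrapper once `Basic/CSS.lean` lands: the fields are `HX`, `HZ`, `HX_mul_HZ_transpose`).
-/

namespace Summit.Ventures.QEC.HGP

open Matrix
open scoped Kronecker
open Literature.InformationTheory.QuantumCodes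
open Literature.InformationTheory.Coding (minDist)

variable {m₁ n₁ m₂ n₂ : ℕ}

/-- `H_X = [H₁ ⊗ 1 | 1 ⊗ H₂ᵀ]` of the hypergraph product `HGP(H₁,H₂)`; rows `Fin m₁ × Fin n₂`, qubits
`(Fin n₁ × Fin n₂) ⊕ (Fin m₁ × Fin m₂)`. By definition the vertex–edge incidence matrix of the product
hypergraph `ℋ₁·ℋ₂ᵀ` (Tillich–Zémor); definition (computable).
[cite: TillichZemor2014, §3-§4 and §6 (arXiv v1 chunks p0006 L56-74, p0007 L1-8, p0009 L12-15)] -/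
def HX (H₁ : Matrix (Fin m₁) (Fin n₁) (ZMod 2)) (H₂ : Matrix (Fin m₂) (Fin n₂) (ZMod 2)) :
    Matrix (Fin m₁ × Fin n₂) ((Fin n₁ × Fin n₂) ⊕ (Fin m₁ × Fin m₂)) (ZMod 2) :=
  HypergraphProduct.xMatrix H₁ H₂ᵀ

/-- `H_Z = [1 ⊗ H₂ | H₁ᵀ ⊗ 1]` of the hypergraph product `HGP(H₁,H₂)`; rows `Fin n₁ × Fin m₂`. By definition
the chamber–edge incidence matrix of the product hypergraph `ℋ₁·ℋ₂ᵀ` (Tillich–Zémor); definition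
(computable). [cite: TillichZemor2014, §3-§4 and §6 (arXiv v1 chunks p0006 L82-90, p0007 L1-8, p0009 L12-15)] -/
def HZ (H₁ : Matrix (Fin m₁) (Fin n₁) (ZMod 2)) (H₂ : Matrix (Fin m₂) (Fin n₂) (ZMod 2)) :
    Matrix (Fin n₁ × Fin m₂) ((Fin n₁ × Fin n₂) ⊕ (Fin m₁ × Fin m₂)) (ZMod 2) :=
  HypergraphProduct.zMatrix H₁ H₂ᵀ

/-- Block form of `H_X`: `[H₁ ⊗ 1 | 1 ⊗ H₂ᵀ]` (definitional). [cite: TillichZemor2014, §3-§4 (arXiv v1 chunk p0007 L1-8)] -/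
theorem HX_eq (H₁ : Matrix (Fin m₁) (Fin n₁) (ZMod 2)) (H₂ : Matrix (Fin m₂) (Fin n₂) (ZMod 2)) :
    HX H₁ H₂ = Matrix.fromCols (H₁ ⊗ₖ (1 : Matrix (Fin n₂) (Fin n₂) (ZMod 2)))
      ((1 : Matrix (Fin m₁) (Fin m₁) (ZMod 2)) ⊗ₖ H₂ᵀ) :=
  rfl

/-- Block form of `H_Z`: `[1 ⊗ H₂ | H₁ᵀ ⊗ 1]`. [cite: TillichZemor2014, §3-§4 (arXiv v1 chunk p0007 L1-8)] -/
theorem HZ_eq (H₁ : Matrix (Fin m₁) (Fin n₁) (ZMod 2)) (H₂ : Matrix (Fin m₂) (Fin n₂) (ZMod 2)) :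
    HZ H₁ H₂ = Matrix.fromCols ((1 : Matrix (Fin n₁) (Fin n₁) (ZMod 2)) ⊗ₖ H₂)
      (H₁ᵀ ⊗ₖ (1 : Matrix (Fin m₂) (Fin m₂) (ZMod 2))) := by
  rw [HZ, HypergraphProduct.zMatrix, Matrix.transpose_transpose]

/-- The CSS commutation condition `H_X H_Zᵀ = 0` for `HGP(H₁,H₂)` — "one line over `ZMod 2`": both block
products are `H₁ ⊗ H₂ᵀ` and cancel in characteristic two (Tillich–Zémor Prop. 3). Proved.
[cite: TillichZemor2014, Prop. 3 (arXiv v1 chunk p0007 L44-48)] -/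
theorem HX_mul_HZ_transpose (H₁ : Matrix (Fin m₁) (Fin n₁) (ZMod 2))
    (H₂ : Matrix (Fin m₂) (Fin n₂) (ZMod 2)) : HX H₁ H₂ * (HZ H₁ H₂)ᵀ = 0 :=
  HypergraphProduct.xMatrix_mul_zMatrix_transpose H₁ H₂ᵀ

/-- `rowSpace H_Z ≤ ker H_X`: every `Z`-check is orthogonal to every `X`-check. Proved.
[cite: TillichZemor2014, Prop. 3 (arXiv v1 chunk p0007 L44-48)] -/
theorem rowSpace_HZ_le (H₁ : Matrix (Fin m₁) (Fin n₁) (ZMod 2)) (H₂ : Matrix (Fin m₂) (Fin n₂) (ZMod 2)) :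
    rowSpace (HZ H₁ H₂) ≤ pcCode (HX H₁ H₂) :=
  HypergraphProduct.rowSpace_zMatrix_le H₁ H₂ᵀ

/-- `rowSpace H_X ≤ ker H_Z`. Proved. [cite: TillichZemor2014, Prop. 3 (arXiv v1 chunk p0007 L44-48)] -/
theorem rowSpace_HX_le (H₁ : Matrix (Fin m₁) (Fin n₁) (ZMod 2)) (H₂ : Matrix (Fin m₂) (Fin n₂) (ZMod 2)) :
    rowSpace (HX H₁ H₂) ≤ pcCode (HZ H₁ H₂) :=
  HypergraphProduct.rowSpace_xMatrix_le H₁ H₂ᵀ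

/-- The number of qubits of `HGP(H₁,H₂)` is `n₁n₂ + m₁m₂`. Proved (cardinality of the index type).
[cite: BreuckmannEberhardt2021, §4.1 (arXiv chunk p0009 L21)] -/
theorem card_qubits (m₁ n₁ m₂ n₂ : ℕ) :
    Fintype.card ((Fin n₁ × Fin n₂) ⊕ (Fin m₁ × Fin m₂)) = n₁ * n₂ + m₁ * m₂ := by
  simp

end Summit.Ventures.QEC.HGP
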